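import Mathlib.Topology.Algebra.OpenSubgroup
import Literature.AnabelianGeometry.SemiGraphs.TemperedReconstructionEdgeVertexProofs
import Literature.AnabelianGeometry.SemiGraphs.TemperedCompactInVerticialAt
import HarnessLib

/-!
# Semi-graphs of anabelioids, §3: Corollary 3.9, step (b) — the two branches of an edge under a
# quasi-geometric homomorphism, AT ONE PAIR OF GRAPHS

Mochizuki, *Semi-graphs of anabelioids*, Publ. RIMS **42** (2006), §3, Cor. 3.9, proof, p. 42
[cite: MochizukiSemiAnbd2006, Cor 3.9 p.42].

PROOF-ONLY companion (abc-iut cell, L3-lead ruling α4-3 «φ2-CONSUMERS», block B0e, seat abc-iut-L3-d1)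
of `TemperedReconstructionBranchProofs.lean` (abc-iut-L3-t2 lineage): the SAME proof of
`exists_branches_of_isQuasiGeometric`, with the ∀-countable named facts `CompactInVerticial` (Thm. 3.7
(iii)) and `MaximalCompactIffVerticial` (Thm. 3.7 (iv)) replaced by their per-graph forms
(`TemperedCompactInVerticialAt.lean`, abc-iut-w4-d075) at the graphs where the proof instantiates them:
(iii) at `ℋ` only, (iv) at `𝒢` and at `ℋ`.  Port rule (α4-3): `hX X hX c ↦ hXAt hX c`, decl suffix
`_at`; everything else verbatim; the original is untouched.  Nothing here takes a side on [IUTchIII]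
Cor. 3.12, nor on the reading of Def. 3.8 (the hypothesis `hcompat` is explicit); typed ≠ discharged.
-/

open CategoryTheory Topology

namespace Literature.AnabelianGeometry.SemiGraphs

namespace ProfiniteSemiGraph

universe u

variable {𝒢 ℋ : ProfiniteSemiGraph.{u}}

/-- **Branches under the compatible reading of Def. 3.8, from Thm. 3.7 (iii) AT `ℋ` and (iv) AT `𝒢`,
`ℋ`** ([SemiAnbd] Cor. 3.9, proof, p. 42, "a map from the edges of `G` to the edges of `H` which is
compatible with the map obtained above on vertices"; §1 p. 11 "a bijection `e ⥲ e′`"): if `φ` carries any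
two distinct maximal compact subgroups with nontrivial intersection into two DISTINCT maximal compact
subgroups (`hcompat`), then for an edge `e` of `G` with branches `b₁ ≠ b₂` at `v₁`, `v₂` the edge `f_E(e)`
has two distinct branches abutting to `f_V(v₁)` and `f_V(v₂)` respectively (φ2-consumers twin of
`exists_branches_of_isQuasiGeometric`). [cite: MochizukiSemiAnbd2006, Cor 3.9 p.42] -/
theorem exists_branches_of_isQuasiGeometric_at (h37i : VerticialInjective.{u})
    (h37iii : CompactInVerticialAt ℋ) (h37iv𝒢 : MaximalCompactIffVerticialAt 𝒢)
    (h37ivℋ : MaximalCompactIffVerticialAt ℋ)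
    (h𝒢 : Cor39Hypotheses 𝒢) (hℋ : Cor39Hypotheses ℋ) (c𝒢 : TemperedPiChart 𝒢)
    (cℋ : TemperedPiChart ℋ) (φ : c𝒢.G →ₜ* cℋ.G)
    (hcompat : ∀ K₁ H₁ : Subgroup c𝒢.G, IsMaximalCompactSubgroup K₁ → IsMaximalCompactSubgroup H₁ →
      K₁ ≠ H₁ → K₁ ⊓ H₁ ≠ ⊥ → ∃ K₂ H₂ : Subgroup cℋ.G, IsMaximalCompactSubgroup K₂ ∧
        IsMaximalCompactSubgroup H₂ ∧ K₂ ≠ H₂ ∧ K₁.map φ.toMonoidHom ≤ K₂ ∧ H₁.map φ.toMonoidHom ≤ H₂)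
    {fV : 𝒢.graph.Vertex → ℋ.graph.Vertex} {fE : 𝒢.graph.Edge → ℋ.graph.Edge}
    (hfV : ∀ (v : 𝒢.graph.Vertex) (K : Subgroup c𝒢.G), K ∈ verticialSubgroups c𝒢 v →
      ∃ K₂ ∈ verticialSubgroups cℋ (fV v), MapsOntoOpenSubgroupOf φ.toMonoidHom K K₂)
    (hfE : ∀ (e : 𝒢.graph.Edge) (L : Subgroup c𝒢.G), L ∈ edgeLikeSubgroups c𝒢 e →
      ∃ L₂ ∈ edgeLikeSubgroups cℋ (fE e), MapsOntoOpenSubgroupOf φ.toMonoidHom L L₂)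
    {e : 𝒢.graph.Edge} {b₁ b₂ : 𝒢.graph.Branch} (hb : b₁ ≠ b₂) (hb₁ : 𝒢.graph.edgeOf b₁ = e)
    (hb₂ : 𝒢.graph.edgeOf b₂ = e) {v₁ v₂ : 𝒢.graph.Vertex} (hv₁ : 𝒢.graph.abuts b₁ = some v₁)
    (hv₂ : 𝒢.graph.abuts b₂ = some v₂) :
    ∃ c₁ c₂ : ℋ.graph.Branch, c₁ ≠ c₂ ∧ ℋ.graph.edgeOf c₁ = fE e ∧ ℋ.graph.edgeOf c₂ = fE e ∧
      ℋ.graph.abuts c₁ = some (fV v₁) ∧ ℋ.graph.abuts c₂ = some (fV v₂) := by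
  haveI := cℋ.t2Space
  have h37𝒢 := h𝒢.thm37Hypotheses
  have h37ℋ := hℋ.thm37Hypotheses
  obtain ⟨hmax𝒢, -⟩ := h37iv𝒢 h37𝒢 c𝒢
  obtain ⟨hmaxℋ, -⟩ := h37ivℋ h37ℋ cℋ
  -- a nontrivial edge-like `L` at `e` and the source pair `H₁ ≠ H₂` of verticial subgroups over it
  obtain ⟨L, hL, hL0⟩ := exists_mem_edgeLikeSubgroups_ne_bot h37i h𝒢 c𝒢 e
  obtain ⟨H₁, hH₁, H₂, hH₂, hne, hLH₁, hLH₂⟩ :=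
    exists_verticial_pair_of_mem_edgeLikeSubgroups h37i h𝒢 c𝒢 hb hb₁ hb₂ hv₁ hv₂ hL
  -- compatible targets `K₂ ≠ K₂'`, verticial at `fV v₁`, `fV v₂`
  obtain ⟨K₂, K₂', hK₂, hK₂', hKne, hle₁, hle₂⟩ := hcompat H₁ H₂ ((hmax𝒢 H₁).mpr ⟨v₁, hH₁⟩)
    ((hmax𝒢 H₂).mpr ⟨v₂, hH₂⟩) hne (fun h0 => hL0 (le_bot_iff.mp (h0 ▸ le_inf hLH₁ hLH₂)))
  obtain ⟨u₁, hK₂u₁⟩ := (hmaxℋ K₂).mp hK₂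
  obtain ⟨u₂, hK₂'u₂⟩ := (hmaxℋ K₂').mp hK₂'
  obtain ⟨M₁, hM₁, hmaps₁⟩ := hfV v₁ H₁ hH₁
  obtain ⟨M₂, hM₂, hmaps₂⟩ := hfV v₂ H₂ hH₂
  have hu₁ : fV v₁ = u₁ := vertex_eq_of_mapsOnto_of_le verticialDistinct_holds h37ℋ cℋ
    φ.toMonoidHom hM₁ hK₂u₁ hmaps₁ hle₁
  have hu₂ : fV v₂ = u₂ := vertex_eq_of_mapsOnto_of_le verticialDistinct_holds h37ℋ cℋ
    φ.toMonoidHom hM₂ hK₂'u₂ hmaps₂ hle₂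
  -- the target edge `fE e`, its branches and the target pair `H₁' ≠ H₂'`
  obtain ⟨L₂, hL₂, hmapsL⟩ := hfE e L hL
  obtain ⟨c₁, c₂, hc, hc₁, hc₂, -⟩ := ℋ.graph.two_branches (fE e)
  obtain ⟨w₁, hw₁⟩ := Option.isSome_iff_exists.mp (hℋ.isGraph.abuts_isSome c₁)
  obtain ⟨w₂, hw₂⟩ := Option.isSome_iff_exists.mp (hℋ.isGraph.abuts_isSome c₂)
  obtain ⟨H₁', hH₁', H₂', hH₂', hne', hL₂H₁', hL₂H₂'⟩ :=
    exists_verticial_pair_of_mem_edgeLikeSubgroups h37i hℋ cℋ hc hc₁ hc₂ hw₁ hw₂ hL₂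
  -- `C := φ(L)`: nontrivial compact, in `H₁'`, `H₂'`, `K₂`, `K₂'`
  have hC : IsCompact ((L.map φ.toMonoidHom : Subgroup cℋ.G) : Set cℋ.G) := by
    rw [Subgroup.coe_map]
    exact (isCompact_of_mem_edgeLikeSubgroups c𝒢 hL).image φ.continuous
  haveI : Infinite L₂ := infinite_of_mem_edgeLikeSubgroups h37i h37ℋ cℋ hL₂
  have hC0 : L.map φ.toMonoidHom ≠ ⊥ := by
    intro h0
    have h1 := relIndex_ne_zero_of_mapsOnto φ.toMonoidHom
      (isCompact_of_mem_edgeLikeSubgroups cℋ hL₂) hmapsL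
    rw [h0, Subgroup.relIndex_bot_left, Nat.card_eq_zero_of_infinite] at h1
    exact h1 rfl
  obtain ⟨hall, -⟩ := (h37iii h37ℋ cℋ _ hC).2 hC0 w₁ w₂ H₁' H₂' hH₁' hH₂' hne'
    (hmapsL.1.trans hL₂H₁') (hmapsL.1.trans hL₂H₂')
  have hK₂mem := hall u₁ K₂ hK₂u₁ ((Subgroup.map_mono hLH₁).trans hle₁)
  have hK₂'mem := hall u₂ K₂' hK₂'u₂ ((Subgroup.map_mono hLH₂).trans hle₂)
  -- `{K₂, K₂'} = {H₁', H₂'}` as `K₂ ≠ K₂'`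
  rcases hK₂mem with rfl | rfl <;> rcases hK₂'mem with h' | h'
  · exact absurd h'.symm hKne
  · subst h'
    exact ⟨c₁, c₂, hc, hc₁, hc₂,
      hu₁ ▸ (vertex_eq_of_mem_verticialSubgroups h37ℋ cℋ hK₂u₁ hH₁') ▸ hw₁,
      hu₂ ▸ (vertex_eq_of_mem_verticialSubgroups h37ℋ cℋ hK₂'u₂ hH₂') ▸ hw₂⟩
  · subst h'
    exact ⟨c₂, c₁, hc.symm, hc₂, hc₁,
      hu₁ ▸ (vertex_eq_of_mem_verticialSubgroups h37ℋ cℋ hK₂u₁ hH₂') ▸ hw₂,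
      hu₂ ▸ (vertex_eq_of_mem_verticialSubgroups h37ℋ cℋ hK₂'u₂ hH₁') ▸ hw₁⟩
  · exact absurd h'.symm hKne

end ProfiniteSemiGraph

end Literature.AnabelianGeometry.SemiGraphs
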